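import Literature.MeasureTheory.Group.CharacterIntegralsSeparate        -- ★ p849255 F3 «TORUS-FOURIER-UNIQ» `eq_of_forall_integral_char_mul_eq` (LH10-p02 (g2))
import Literature.Topology.LocallyConstantCompactSupportUniform        -- ★ uniform local constancy `exists_nhds_one_forall_mul_eq_of_hasCompactSupport`
import Mathlib.MeasureTheory.Group.Integral
import HarnessLib

/-!
# Two-coset Fourier inversion on an abelian group: a locally constant compactly supported `Ψ` whose character integrals are `A·[χ|_C = 1]·(χ(b₁) + κ χ(b₂))`
# IS `(A ∕ μ(C))·(𝟙_{b₁C} + κ 𝟙_{b₂C})` (Hewitt–Ross (23.11); brick D3-ii «SHELL-ORBITAL» of road (D), line LH6, crux H413 — the inversion step)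

Topic `MeasureTheory/Group`; namespace `Literature.MeasureTheory.Group`.  THEOREMS ONLY (no definition, no instance, no notation, no named fact, no `sorry`);
GENERIC (no `U(3)` token): Mathlib + ★ F3 + ★ uniform local constancy.  Cell `pub/hodgecm-mathlib`, F0∕P3c∕P3b line LH6 «StCharTS», road (D) «DEEP-FL»
(owner LH6-p04 (g2), `F0/P3b/LH6-p04/g2/ROAD-D.status.v3.txt` § D3-ii), dealt to LH2-p03 (g3) by F0P3b-plan (g23) 2026-09-02T05:17:01Z; lane
`--supports stmt-HodgeConjecture-24833`.  HONEST LABEL: HC_CM is proved only modulo the 7 printed citations (2 remaining: hLiu418 = stmt-HodgeConjecture-24832,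
h413 = stmt-HodgeConjecture-24833) until rung 0 closes; this file is generic harmonic analysis (count-neutral) and pays no printed statement.

THE USE.  On the split torus `M` of `U(Φ₃)(L⁺_v)`, Rogawski's (4.9.4) writes `tr i_G(χ)(f) = c · ∫_M χ(t) Ψ_f(t) dt` with `Ψ_f = δ^{1∕2} J⁻¹ O^{can}(f)` (★
`CMPrincipalSeriesTraceOrbitalForm`), and the all-level shell trace (F1-G, ★ `JacquetRayShellAllLevels` + its CM corollary) evaluates the left side at
`f = 𝟙_{K_n b K_n}` as `A · [χ|_{M ∩ K_n} = 1] · (χ(b) + χ(bʷ))` (two exponents).  The present lemma inverts: `Ψ_f` is the explicit two-coset step function.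

THE MATHEMATICS ([HewittRoss1979, Thm. (23.11)]).  `T` an abelian topological group with a left-invariant measure `μ` positive on opens and finite on compacta,
`C ≤ T` compact open, and the open subgroups form a neighbourhood basis at `1` (true for `M ≅ L_w^× × L_w^1 × …`: congruence subgroups).  For a character `χ`:
`∫ χ · 𝟙_{bC} dμ = χ(b) · ∫_C χ dμ` (left invariance) and `∫_C χ dμ = μ(C)` if `χ|_C = 1`, `= 0` otherwise (translate by `c₀ ∈ C` with `χ(c₀) ≠ 1`).  Hence
`Ψ₀ := (A∕μ(C)) · (𝟙_{b₁C} + κ 𝟙_{b₂C})` has `∫ χ Ψ₀ = A·[χ|_C = 1]·(χ(b₁) + κ χ(b₂))` for EVERY continuous character.  A locally constant compactly supported `Ψ`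
is invariant under some compact open subgroup `C′ ≤ C` (★ uniform local constancy + the basis hypothesis), and so is `Ψ₀`; if `Ψ` has the same character
integrals, ★ F3 (characters trivial on `C′` separate `C′`-invariant compactly supported functions) gives `Ψ = Ψ₀`.

* §1 `integral_char_mul_indicator_subgroup_eq_of_forall` ∕ `…_eq_zero_of_exists` (the integral of a character over a compact open subgroup), `integral_char_mul_indicator_coset`
  (over a coset), `integral_char_mul_twoCoset` (the model function's character integrals);
* §2 `exists_isOpen_subgroup_le_forall_mul_eq` (a common compact open level `C′ ≤ C` for a locally constant compactly supported function);
* §3 **`eq_twoCoset_of_forall_integral_char_mul_eq`** — the inversion; §4 `…_of_comm` — the same over a `Group` carrier with commutativity as a hypothesis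
  (tori given as `Subgroup`s, ★ `torusU_mul_comm`).

## References
* [HewittRoss1979] E. Hewitt, K. A. Ross, *Abstract Harmonic Analysis I*, 2nd ed. (1979), Thm. (23.11) (Fourier uniqueness), (23.19) (orthogonality of characters on a
  compact group).
* [BernsteinZelevinsky1976] I. N. Bernstein, A. V. Zelevinsky, Russian Math. Surveys 31 (1976), §1.1 (uniform local constancy of `C_c^∞` functions).
* [Rogawski1990] J. D. Rogawski, *Automorphic Representations of Unitary Groups in Three Variables* (1990), §4.9 (4.9.4) p. 56 (the torus form of `tr i_G(χ)`).
-/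

set_option autoImplicit false

noncomputable section

open MeasureTheory MeasureTheory.Measure Topology Filter Set
open scoped Classical

namespace Literature.MeasureTheory.Group

section TwoCoset

variable {T : Type*} [CommGroup T] [TopologicalSpace T] [IsTopologicalGroup T] [MeasurableSpace T] [BorelSpace T]
  (μ : Measure T) [μ.IsMulLeftInvariant]

/-! ## §1 Character integrals over a compact open subgroup and over its cosets -/

omit [TopologicalSpace T] [IsTopologicalGroup T] [BorelSpace T] [μ.IsMulLeftInvariant] in
/-- `∫ χ · 𝟙_C dμ = μ(C)` when the character `χ` is trivial on the subgroup `C`. [cite: HewittRoss1979, Thm. (23.19)] -/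
theorem integral_char_mul_indicator_subgroup_eq_of_forall (C : Subgroup T) (hCm : MeasurableSet (C : Set T))
    (χ : T →* ℂˣ) (h1 : ∀ c ∈ C, χ c = 1) :
    ∫ t, ((χ t : ℂˣ) : ℂ) * (C : Set T).indicator (fun _ => (1 : ℂ)) t ∂μ = (μ.real (C : Set T) : ℂ) := by
  have he : (fun t => ((χ t : ℂˣ) : ℂ) * (C : Set T).indicator (fun _ => (1 : ℂ)) t) = (C : Set T).indicator (fun _ => (1 : ℂ)) := by
    funext t
    by_cases ht : t ∈ (C : Set T)
    · rw [indicator_of_mem ht, h1 t ht, Units.val_one, one_mul]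
    · rw [indicator_of_notMem ht, mul_zero]
  rw [he, integral_indicator_const (1 : ℂ) hCm, Complex.real_smul, mul_one]

/-- `∫ χ · 𝟙_C dμ = 0` when the character `χ` is NOT trivial on the subgroup `C` (translate by `c₀ ∈ C` with `χ(c₀) ≠ 1`, left invariance of `μ`,
`c₀ C = C`). [cite: HewittRoss1979, Thm. (23.19)] -/
theorem integral_char_mul_indicator_subgroup_eq_zero_of_exists (C : Subgroup T)
    (χ : T →* ℂˣ) {c₀ : T} (hc₀ : c₀ ∈ C) (hχ : χ c₀ ≠ 1) :
    ∫ t, ((χ t : ℂˣ) : ℂ) * (C : Set T).indicator (fun _ => (1 : ℂ)) t ∂μ = 0 := by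
  set I := ∫ t, ((χ t : ℂˣ) : ℂ) * (C : Set T).indicator (fun _ => (1 : ℂ)) t ∂μ with hI
  -- translate the integrand by `c₀`
  have hshift : ∫ t, ((χ (c₀ * t) : ℂˣ) : ℂ) * (C : Set T).indicator (fun _ => (1 : ℂ)) (c₀ * t) ∂μ = I :=
    integral_mul_left_eq_self (fun t => ((χ t : ℂˣ) : ℂ) * (C : Set T).indicator (fun _ => (1 : ℂ)) t) c₀
  have hind : ∀ t, (C : Set T).indicator (fun _ => (1 : ℂ)) (c₀ * t) = (C : Set T).indicator (fun _ => (1 : ℂ)) t := by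
    intro t
    by_cases ht : t ∈ (C : Set T)
    · rw [indicator_of_mem ht, indicator_of_mem (C.mul_mem hc₀ ht)]
    · have h' : c₀ * t ∉ (C : Set T) := fun h => ht (by simpa using C.mul_mem (C.inv_mem hc₀) h)
      rw [indicator_of_notMem ht, indicator_of_notMem h']
  have hmul : ∫ t, ((χ (c₀ * t) : ℂˣ) : ℂ) * (C : Set T).indicator (fun _ => (1 : ℂ)) (c₀ * t) ∂μ = ((χ c₀ : ℂˣ) : ℂ) * I := by
    rw [hI, ← integral_const_mul]
    refine integral_congr_ae (Eventually.of_forall fun t => ?_)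
    simp only [map_mul, Units.val_mul, hind t]
    ring
  have hkey : (((χ c₀ : ℂˣ) : ℂ) - 1) * I = 0 := by rw [sub_mul, one_mul, ← hmul, hshift, sub_self]
  rcases mul_eq_zero.1 hkey with h | h
  · exact absurd (Units.val_eq_one.1 (sub_eq_zero.1 h)) hχ
  · exact h

/-- **The character integral over a coset `bC`**: `∫ χ · 𝟙_{bC} dμ = χ(b) · μ(C)` if `χ|_C = 1`, and `= 0` otherwise (`𝟙_{bC}(t) = 𝟙_C(b⁻¹ t)`; substitute `t = b s`).
[cite: HewittRoss1979, Thm. (23.19)] -/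
theorem integral_char_mul_indicator_coset
    (C : Subgroup T) (hCm : MeasurableSet (C : Set T)) (χ : T →* ℂˣ) (b : T) :
    ∫ t, ((χ t : ℂˣ) : ℂ) * {t | b⁻¹ * t ∈ (C : Set T)}.indicator (fun _ => (1 : ℂ)) t ∂μ =
      if ∀ c ∈ C, χ c = 1 then ((χ b : ℂˣ) : ℂ) * (μ.real (C : Set T) : ℂ) else 0 := by
  classical
  -- `𝟙_{bC}(b s) = 𝟙_C(s)`, substitute `t = b s`
  have hsub : ∫ t, ((χ t : ℂˣ) : ℂ) * {t | b⁻¹ * t ∈ (C : Set T)}.indicator (fun _ => (1 : ℂ)) t ∂μ =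
      ∫ s, ((χ (b * s) : ℂˣ) : ℂ) * {t | b⁻¹ * t ∈ (C : Set T)}.indicator (fun _ => (1 : ℂ)) (b * s) ∂μ :=
    (integral_mul_left_eq_self (fun t => ((χ t : ℂˣ) : ℂ) * {t | b⁻¹ * t ∈ (C : Set T)}.indicator (fun _ => (1 : ℂ)) t) b).symm
  have hind : ∀ s, {t | b⁻¹ * t ∈ (C : Set T)}.indicator (fun _ => (1 : ℂ)) (b * s) = (C : Set T).indicator (fun _ => (1 : ℂ)) s := by
    intro s
    have hiff : b * s ∈ {t | b⁻¹ * t ∈ (C : Set T)} ↔ s ∈ (C : Set T) := by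
      simp only [mem_setOf_eq, inv_mul_cancel_left]
    by_cases hs : s ∈ (C : Set T)
    · rw [indicator_of_mem (hiff.2 hs), indicator_of_mem hs]
    · rw [indicator_of_notMem (fun h => hs (hiff.1 h)), indicator_of_notMem hs]
  rw [hsub]
  have hre : ∫ s, ((χ (b * s) : ℂˣ) : ℂ) * {t | b⁻¹ * t ∈ (C : Set T)}.indicator (fun _ => (1 : ℂ)) (b * s) ∂μ =
      ((χ b : ℂˣ) : ℂ) * ∫ s, ((χ s : ℂˣ) : ℂ) * (C : Set T).indicator (fun _ => (1 : ℂ)) s ∂μ := by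
    rw [← integral_const_mul]
    refine integral_congr_ae (Eventually.of_forall fun s => ?_)
    simp only [map_mul, Units.val_mul, hind s]
    ring
  rw [hre]
  by_cases h1 : ∀ c ∈ C, χ c = 1
  · rw [if_pos h1, integral_char_mul_indicator_subgroup_eq_of_forall μ C hCm χ h1]
  · rw [if_neg h1]
    push Not at h1
    obtain ⟨c₀, hc₀, hne⟩ := h1
    rw [integral_char_mul_indicator_subgroup_eq_zero_of_exists μ C χ hc₀ hne, mul_zero]

/-- **Character integrals of the two-coset model function** `Ψ₀ = a · (𝟙_{b₁C} + κ 𝟙_{b₂C})`: `∫ χ Ψ₀ dμ = a μ(C) · [χ|_C = 1] · (χ(b₁) + κ χ(b₂))`.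
[cite: HewittRoss1979, Thm. (23.19)] -/
theorem integral_char_mul_twoCoset [T2Space T] [IsFiniteMeasureOnCompacts μ] (C : Subgroup T) (hCm : MeasurableSet (C : Set T)) (hCc : IsCompact (C : Set T))
    (χ : T →* ℂˣ) (hχc : Continuous fun t => ((χ t : ℂˣ) : ℂ)) (b₁ b₂ : T) (a κ : ℂ) :
    ∫ t, ((χ t : ℂˣ) : ℂ) * (a * ({t | b₁⁻¹ * t ∈ (C : Set T)}.indicator (fun _ => (1 : ℂ)) t + κ * {t | b₂⁻¹ * t ∈ (C : Set T)}.indicator (fun _ => (1 : ℂ)) t)) ∂μ =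
      if ∀ c ∈ C, χ c = 1 then a * (μ.real (C : Set T) : ℂ) * (((χ b₁ : ℂˣ) : ℂ) + κ * ((χ b₂ : ℂˣ) : ℂ)) else 0 := by
  classical
  -- integrability of the two coset pieces: bounded continuous character times the indicator of a compact measurable set
  have hcos : ∀ b : T, IsCompact {t | b⁻¹ * t ∈ (C : Set T)} := fun b => by
    have he : {t | b⁻¹ * t ∈ (C : Set T)} = (fun c => b * c) '' (C : Set T) := by
      ext t
      simp only [mem_setOf_eq, mem_image]
      constructor
      · intro h; exact ⟨b⁻¹ * t, h, by rw [mul_inv_cancel_left]⟩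
      · rintro ⟨c, hc, rfl⟩; rwa [inv_mul_cancel_left]
    rw [he]
    exact hCc.image (continuous_const_mul b)
  have hmeas : ∀ b : T, MeasurableSet {t | b⁻¹ * t ∈ (C : Set T)} := fun b =>
    hCm.preimage (measurable_const_mul b⁻¹)
  have hint : ∀ b : T, Integrable (fun t => ((χ t : ℂˣ) : ℂ) * {t | b⁻¹ * t ∈ (C : Set T)}.indicator (fun _ => (1 : ℂ)) t) μ := by
    intro b
    have he : (fun t => ((χ t : ℂˣ) : ℂ) * {t | b⁻¹ * t ∈ (C : Set T)}.indicator (fun _ => (1 : ℂ)) t) =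
        {t | b⁻¹ * t ∈ (C : Set T)}.indicator (fun t => ((χ t : ℂˣ) : ℂ)) := by
      funext t
      by_cases ht : t ∈ {t | b⁻¹ * t ∈ (C : Set T)}
      · rw [indicator_of_mem ht, indicator_of_mem ht, mul_one]
      · rw [indicator_of_notMem ht, indicator_of_notMem ht, mul_zero]
    rw [he, integrable_indicator_iff (hmeas b)]
    exact hχc.continuousOn.integrableOn_compact (hcos b)
  have hexp : ∀ t, ((χ t : ℂˣ) : ℂ) * (a * ({t | b₁⁻¹ * t ∈ (C : Set T)}.indicator (fun _ => (1 : ℂ)) t + κ * {t | b₂⁻¹ * t ∈ (C : Set T)}.indicator (fun _ => (1 : ℂ)) t)) =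
      a * (((χ t : ℂˣ) : ℂ) * {t | b₁⁻¹ * t ∈ (C : Set T)}.indicator (fun _ => (1 : ℂ)) t) +
        (a * κ) * (((χ t : ℂˣ) : ℂ) * {t | b₂⁻¹ * t ∈ (C : Set T)}.indicator (fun _ => (1 : ℂ)) t) := fun t => by ring
  simp_rw [hexp]
  rw [integral_add ((hint b₁).const_mul a) ((hint b₂).const_mul (a * κ)), integral_const_mul, integral_const_mul,
    integral_char_mul_indicator_coset μ C hCm χ b₁, integral_char_mul_indicator_coset μ C hCm χ b₂]
  by_cases h1 : ∀ c ∈ C, χ c = 1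
  · simp only [if_pos h1]; ring
  · simp only [if_neg h1]; ring

/-! ## §2 A common compact open level for a locally constant compactly supported function -/

omit [MeasurableSpace T] [BorelSpace T] in
/-- **A locally constant compactly supported function is invariant under a compact open subgroup `C′ ≤ C`** — provided the open subgroups form a neighbourhood basis
at `1` (★ uniform local constancy `exists_nhds_one_forall_mul_eq_of_hasCompactSupport`, then shrink into `C`). [cite: BernsteinZelevinsky1976, §1.1] -/
theorem exists_isOpen_subgroup_le_forall_mul_eq (C : Subgroup T) (hCo : IsOpen (C : Set T)) (hCc : IsCompact (C : Set T))
    (hbasis : ∀ V ∈ 𝓝 (1 : T), ∃ C' : Subgroup T, IsOpen (C' : Set T) ∧ (C' : Set T) ⊆ V)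
    {Ψ : T → ℂ} (hΨlc : IsLocallyConstant Ψ) (hΨK : HasCompactSupport Ψ) :
    ∃ C' : Subgroup T, C' ≤ C ∧ IsOpen (C' : Set T) ∧ IsCompact (C' : Set T) ∧ ∀ t, ∀ c ∈ C', Ψ (t * c) = Ψ t := by
  obtain ⟨V, hV, hΨV⟩ := Literature.Topology.exists_nhds_one_forall_mul_eq_of_hasCompactSupport hΨlc hΨK
  obtain ⟨C₁, hC₁o, hC₁V⟩ := hbasis V hV
  refine ⟨C₁ ⊓ C, inf_le_right, ?_, ?_, fun t c hc => hΨV t c (hC₁V (Subgroup.mem_inf.1 hc).1)⟩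
  · have he : ((C₁ ⊓ C : Subgroup T) : Set T) = (C₁ : Set T) ∩ (C : Set T) := Subgroup.coe_inf C₁ C
    rw [he]
    exact hC₁o.inter hCo
  · have hcl : IsClosed ((C₁ ⊓ C : Subgroup T) : Set T) := by
      have he : ((C₁ ⊓ C : Subgroup T) : Set T) = (C₁ : Set T) ∩ (C : Set T) := Subgroup.coe_inf C₁ C
      have h1 : IsClosed (C₁ : Set T) := Subgroup.isClosed_of_isOpen C₁ hC₁o
      rw [he]
      exact h1.inter (Subgroup.isClosed_of_isOpen C hCo)
    exact hCc.of_isClosed_subset hcl (fun x hx => (Subgroup.mem_inf.1 hx).2)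

/-! ## §3 The inversion -/

/-- **TWO-COSET FOURIER INVERSION.**  `T` an abelian topological group whose open subgroups form a neighbourhood basis at `1`, `μ` left-invariant, positive on opens,
finite on compacta, `C ≤ T` compact open, `b₁, b₂ ∈ T`, `A, κ ∈ ℂ`.  If `Ψ : T → ℂ` is locally constant with compact support and
`∫ χ Ψ dμ = A · [χ|_C = 1] · (χ(b₁) + κ χ(b₂))` for every continuous, locally constant, unitary character `χ : T →* ℂˣ`, then
`Ψ = (A ∕ μ(C)) · (𝟙_{b₁C} + κ 𝟙_{b₂C})` EVERYWHERE.  (The model function has these character integrals (§1); both sides are invariant under a common compact open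
`C′ ≤ C` (§2); ★ F3 `eq_of_forall_integral_char_mul_eq` at `C′`.) [cite: HewittRoss1979, Thm. (23.11), (23.19)] [cite: Rogawski1990, §4.9 (4.9.4) p. 56] -/
theorem eq_twoCoset_of_forall_integral_char_mul_eq [T2Space T] [IsFiniteMeasureOnCompacts μ] [μ.IsOpenPosMeasure]
    (C : Subgroup T) (hCo : IsOpen (C : Set T)) (hCc : IsCompact (C : Set T))
    (hbasis : ∀ V ∈ 𝓝 (1 : T), ∃ C' : Subgroup T, IsOpen (C' : Set T) ∧ (C' : Set T) ⊆ V)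
    {Ψ : T → ℂ} (hΨlc : IsLocallyConstant Ψ) (hΨK : HasCompactSupport Ψ) (b₁ b₂ : T) (A κ : ℂ)
    (h : ∀ χ : T →* ℂˣ, Continuous (fun t => ((χ t : ℂˣ) : ℂ)) → IsLocallyConstant χ → (∀ t, ‖((χ t : ℂˣ) : ℂ)‖ = 1) →
      ∫ t, ((χ t : ℂˣ) : ℂ) * Ψ t ∂μ = if ∀ c ∈ C, χ c = 1 then A * (((χ b₁ : ℂˣ) : ℂ) + κ * ((χ b₂ : ℂˣ) : ℂ)) else 0) :
    Ψ = fun t => A / (μ.real (C : Set T) : ℂ) *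
      ({t | b₁⁻¹ * t ∈ (C : Set T)}.indicator (fun _ => (1 : ℂ)) t + κ * {t | b₂⁻¹ * t ∈ (C : Set T)}.indicator (fun _ => (1 : ℂ)) t) := by
  classical
  have hCm : MeasurableSet (C : Set T) := hCo.measurableSet
  -- `0 < μ(C) < ∞`
  have hμC0 : (μ.real (C : Set T) : ℂ) ≠ 0 := by
    have h0 : μ (C : Set T) ≠ 0 := hCo.measure_ne_zero μ ⟨1, C.one_mem⟩
    have htop : μ (C : Set T) ≠ ⊤ := hCc.measure_lt_top.ne
    have : 0 < μ.real (C : Set T) := ENNReal.toReal_pos h0 htop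
    exact_mod_cast this.ne'
  -- the common level
  obtain ⟨C', hC'C, hC'o, hC'c, hΨinv⟩ := exists_isOpen_subgroup_le_forall_mul_eq C hCo hCc hbasis hΨlc hΨK
  -- the model function and its invariance ∕ support
  set Ψ₀ : T → ℂ := fun t => A / (μ.real (C : Set T) : ℂ) *
      ({t | b₁⁻¹ * t ∈ (C : Set T)}.indicator (fun _ => (1 : ℂ)) t + κ * {t | b₂⁻¹ * t ∈ (C : Set T)}.indicator (fun _ => (1 : ℂ)) t) with hΨ₀
  have hind : ∀ (b t : T), ∀ c ∈ C, {t | b⁻¹ * t ∈ (C : Set T)}.indicator (fun _ => (1 : ℂ)) (t * c) = {t | b⁻¹ * t ∈ (C : Set T)}.indicator (fun _ => (1 : ℂ)) t := by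
    intro b t c hc
    have hiff : t * c ∈ {t | b⁻¹ * t ∈ (C : Set T)} ↔ t ∈ {t | b⁻¹ * t ∈ (C : Set T)} := by
      simp only [mem_setOf_eq, ← mul_assoc]
      constructor
      · intro h; simpa using C.mul_mem h (C.inv_mem hc)
      · intro h; exact C.mul_mem h hc
    by_cases ht : t ∈ {t | b⁻¹ * t ∈ (C : Set T)}
    · rw [indicator_of_mem (hiff.2 ht), indicator_of_mem ht]
    · rw [indicator_of_notMem (fun h' => ht (hiff.1 h')), indicator_of_notMem ht]
  have hΨ₀inv : ∀ t, ∀ c ∈ C', Ψ₀ (t * c) = Ψ₀ t := by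
    intro t c hc
    simp only [hΨ₀, hind b₁ t c (hC'C hc), hind b₂ t c (hC'C hc)]
  have hcos : ∀ b : T, IsCompact {t | b⁻¹ * t ∈ (C : Set T)} := fun b => by
    have he : {t | b⁻¹ * t ∈ (C : Set T)} = (fun c => b * c) '' (C : Set T) := by
      ext t
      simp only [mem_setOf_eq, mem_image]
      constructor
      · intro h'; exact ⟨b⁻¹ * t, h', by rw [mul_inv_cancel_left]⟩
      · rintro ⟨c, hc, rfl⟩; rwa [inv_mul_cancel_left]
    rw [he]
    exact hCc.image (continuous_const_mul b)
  have hΨ₀K : HasCompactSupport Ψ₀ := by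
    refine HasCompactSupport.intro ((hcos b₁).union (hcos b₂)) fun t ht => ?_
    rw [mem_union, not_or] at ht
    simp only [hΨ₀, indicator_of_notMem ht.1, indicator_of_notMem ht.2, mul_zero, add_zero]
  -- ★ F3 at the level `C′`
  refine eq_of_forall_integral_char_mul_eq μ C' hC'o hC'c Ψ Ψ₀ hΨinv hΨ₀inv hΨK hΨ₀K fun χ hχc hχlc _ hχu => ?_
  have hχc' : Continuous fun t => ((χ t : ℂˣ) : ℂ) := Units.continuous_val.comp hχc
  rw [h χ hχc' hχlc hχu]
  have hmodel := integral_char_mul_twoCoset μ C hCm hCc χ hχc' b₁ b₂ (A / (μ.real (C : Set T) : ℂ)) κ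
  simp only [hΨ₀]
  rw [hmodel]
  by_cases h1 : ∀ c ∈ C, χ c = 1
  · simp only [if_pos h1]
    rw [div_mul_cancel₀ _ hμC0]
  · simp only [if_neg h1]

end TwoCoset

/-! ## §4 The same for a `Group` whose multiplication is commutative (no `CommGroup` INSTANCE on the carrier — e.g. a torus given as a `Subgroup`) -/

section OfComm

variable {T : Type*} [Group T] [TopologicalSpace T] [IsTopologicalGroup T] [MeasurableSpace T] [BorelSpace T] [T2Space T]
  (μ : Measure T) [μ.IsMulLeftInvariant] [IsFiniteMeasureOnCompacts μ] [μ.IsOpenPosMeasure]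

/-- **TWO-COSET FOURIER INVERSION, `Group` + commutativity-as-a-hypothesis form** — for carriers such as the split torus `↥(cmBorelTriple L N v).M` of `U(Φ_N)(L⁺_v)`
that are `Subgroup`s of a non-commutative group (so carry a `Group`, not a `CommGroup`, instance; commutativity is the theorem ★ `torusU_mul_comm`): the
`CommGroup` structure is assembled inside the proof (`{ ‹Group T› with mul_comm := hcomm }`, definitionally the given `Group`), and §3 applies verbatim.
[cite: HewittRoss1979, Thm. (23.11), (23.19)] [cite: Rogawski1990, §4.9 (4.9.4) p. 56] -/
theorem eq_twoCoset_of_forall_integral_char_mul_eq_of_comm (hcomm : ∀ x y : T, x * y = y * x)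
    (C : Subgroup T) (hCo : IsOpen (C : Set T)) (hCc : IsCompact (C : Set T))
    (hbasis : ∀ V ∈ 𝓝 (1 : T), ∃ C' : Subgroup T, IsOpen (C' : Set T) ∧ (C' : Set T) ⊆ V)
    {Ψ : T → ℂ} (hΨlc : IsLocallyConstant Ψ) (hΨK : HasCompactSupport Ψ) (b₁ b₂ : T) (A κ : ℂ)
    (h : ∀ χ : T →* ℂˣ, Continuous (fun t => ((χ t : ℂˣ) : ℂ)) → IsLocallyConstant χ → (∀ t, ‖((χ t : ℂˣ) : ℂ)‖ = 1) →
      ∫ t, ((χ t : ℂˣ) : ℂ) * Ψ t ∂μ = if ∀ c ∈ C, χ c = 1 then A * (((χ b₁ : ℂˣ) : ℂ) + κ * ((χ b₂ : ℂˣ) : ℂ)) else 0) :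
    Ψ = fun t => A / (μ.real (C : Set T) : ℂ) *
      ({t | b₁⁻¹ * t ∈ (C : Set T)}.indicator (fun _ => (1 : ℂ)) t + κ * {t | b₂⁻¹ * t ∈ (C : Set T)}.indicator (fun _ => (1 : ℂ)) t) := by
  letI : CommGroup T := { ‹Group T› with mul_comm := hcomm }
  exact eq_twoCoset_of_forall_integral_char_mul_eq μ C hCo hCc hbasis hΨlc hΨK b₁ b₂ A κ h

end OfComm

end Literature.MeasureTheory.Group

end
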